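import Summits.QuantumFields.BalabanUV.T4Continuum.Support.LatticeSupFromEnergy
import Summits.QuantumFields.BalabanUV.T4Continuum.Support.LatticeSupInterpolation

/-!
# T⁴ programme, spine nodes NE2 × NE3 — THE ℓ² → SUP INTERPOLATION, OPTIMISED FORM (the one real-analysis step left
# «to the consumer» by `LatticeSupFromEnergy` p214980 and `LatticeSupInterpolation`)

NE3 (node U1b) formalisation swarm `b2b-balaban-t4-ne3-formalise-*`, leaf prover 02 (gen 3); LEAVES.md row S5∕S6,
candidate **S6-Y12** («(M1″) lattice sup-interpolation», typer ρ28 — a cross-node request from GAPS G-ne2leaf08g2-1),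
RE-SCOPED to its remainder after the CHECK against the tree (journal «CHECK S6-Y12 vs p214980», SHAPE
`t4/formal/NE3/Statements/S6-Y12-SHAPE-v1.md`).  WHAT THE TREE ALREADY HAS.  NE2 leaf-08 g2's
`LatticeSupFromEnergy.norm_le_of_stepLipschitz_of_sum_sq` (p214980): for a step-Lipschitz `f : Tor N → E`
(`‖f (x + e_μ) − f x‖ ≤ λ`) and EVERY cube side `r < N_μ`,
`‖f x₀‖ ≤ d·r·λ + √(Σ_x ‖f x‖²) ∕ √((r+1)^d)`; road P3's `LatticeSupInterpolation.abs_le_modulus_add_mass` is the same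
counting core on an anchored box of `ℤ^d`.  Both files leave the OPTIMISATION IN `r` to «the consumer», and the consumer
(`T4ConvexResponse.localRate_of_interpolation`, hypothesis `hI : |Δloc| ≤ C_I·E^a·M^{1−a}`, `a = 2∕(d+2)`) wants the
CLOSED form.  THIS FILE does exactly that optimisation and nothing else:

* §1 (pure real analysis) at the balance point `ρ := (B∕A)^{2∕(d+2)}` one has `A·ρ = B∕√(ρ^d) = A^{d∕(d+2)}·B^{2∕(d+2)}`
  (`opt_identities`); the admissible integer side `r := min ⌊ρ⌋₊ (n − 1)` gives `le_opt_core`, whence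
  **`le_two_mul_rpow_add_of_forall_lt`**: `(∀ r < n, y ≤ A·r + B∕√((r+1)^d)) → y ≤ 2·A^{d∕(d+2)}·B^{2∕(d+2)} + B∕√(n^d)`,
  and in the bulk regime `B² ≤ A²·n^{d+2}` (⇔ `ρ ≤ n`) the cut-off term is not needed (`…_of_sq_le`);
  `rpow_mul_rpow_sqrt_eq` rewrites `A^{d∕(d+2)}·(√S)^{2∕(d+2)} = (A^d·S)^{1∕(d+2)}`.
* §2 (lattice, over p214980 BY NAME) **`norm_le_rpow_of_stepLipschitz`**: for `1 ≤ n ≤ N_μ` (all `μ`),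
  `‖f x₀‖ ≤ 2·((d·λ)^d · Σ_x ‖f x‖²)^{1∕(d+2)} + √(Σ_x ‖f x‖²) ∕ √(n^d)` — the mean-square cut-off is NECESSARY
  (constants have `λ = 0`); the bulk-regime form `‖f x₀‖ ≤ 2·(d·λ)^{d∕(d+2)}·(√Σ)^{2∕(d+2)}` is literally the `hI` shape
  (`E = √Σ`, `M = d·λ`, `a = 2∕(d+2)`, `C_I = 2`); with `λ = Λ·η` (a `Λ`-Lipschitz field sampled at mesh `η`) the
  displayed constant of ρ28 is **`C_d = 2·d^{d∕(d+2)}`** (`norm_le_rpow_of_lipschitz_mesh`; `≤ 2d`; `2·4^{2∕3} ≈ 5.04` at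
  `d = 4`); `norm_le_sqrt_sum_sq` is the trivial bound `‖f x₀‖ ≤ √Σ`, hypothesis-free.
* §3 (anchored boxes of `ℤ^d`, over road P3's `LatticeSupInterpolation.abs_le_modulus_add_mass` BY NAME — its docstring's
  «dictionary `w = h^d`, `M = Λ·d·k·h`; optimise `k`») **`abs_le_rpow_of_modulus_mass`**: lower modulus `|f x₀| − A·k ≤ |f y|`
  on every box of side `k < n` and weighted mass `w·Σ_{box (n−1)} f² ≤ δ²` give
  `|f x₀| ≤ 2·A^{d∕(d+2)}·(δ∕√w)^{2∕(d+2)} + (δ∕√w)∕√(n^d)` — the same optimisation serves the NE3-side reading (F₀).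

HONEST FRAMING (T4-DAG p. 1).  Elementary real analysis ([folklore]) on ONE function on ONE torus — not NE3 in disguise
(no configuration, no minimiser, no two spacings, no rate); closes NOTHING of NE2 ∕ NE3 by itself (G-ne2leaf08g2-1's
closers (M1′) ROOT B at a general rate and (M3′) the inter-level gauge statement are untouched; (M1) only receives its
arithmetic); NE3 NOT proved; spine PROVED 0∕9 unchanged; finite T⁴ rung (B)+1; NOT infinite volume, NOT a mass gap, NOT
`BetaPertH`, NOT the Clay problem.  HONEST DEPENDENCY: continuum YM on T⁴ ⇐ BetaPertH ∧ nine spine estimates (0/9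
proved); BetaPertH ⇐ (D1) ∧ (D4) ∧ CAP+tail; G-an2-4 gates asym, D1 and NE2/3/4.  ABSOLUTE RULE kept: no
`def … : Prop` fact, nothing of Bałaban's asserted, no `sorry`; imports `Support.LatticeSupFromEnergy` (NE2 leaf-08 g2) and
`Support.LatticeSupInterpolation` (road P3) only — both Mathlib-only below.
-/

noncomputable section

open scoped BigOperators

namespace Summit.QuantumFields.BalabanUV.T4Continuum.LatticeSupOptimised

open Literature.MathematicalPhysics.QuantumFieldTheory.Balaban1983to89.B5Prop11Plancherel (Tor unitVec)
open Summit.QuantumFields.BalabanUV.T4Continuum.LatticeSupFromEnergy (norm_le_of_stepLipschitz_of_sum_sq)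

/-! ## §1 The real optimisation behind `sup ≲ (λ^d·Σ)^{1∕(d+2)}` -/

/-- THE BALANCE POINT.  For `A, B > 0` and `ρ := (B∕A)^{2∕(d+2)}` the two terms of `A·r + B∕√(r^d)` balance at `r = ρ`:
`A·ρ = A^{d∕(d+2)}·B^{2∕(d+2)}` and `B∕√(ρ^d) = A^{d∕(d+2)}·B^{2∕(d+2)}`. [folklore] -/
theorem opt_identities (d : ℕ) {A B : ℝ} (hA : 0 < A) (hB : 0 < B) :
    A * (B / A) ^ ((2 : ℝ) / (d + 2)) = A ^ ((d : ℝ) / (d + 2)) * B ^ ((2 : ℝ) / (d + 2)) ∧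
      B / Real.sqrt (((B / A) ^ ((2 : ℝ) / (d + 2))) ^ d) = A ^ ((d : ℝ) / (d + 2)) * B ^ ((2 : ℝ) / (d + 2)) := by
  have hd2 : (0 : ℝ) < d + 2 := by positivity
  have hBA : 0 ≤ B / A := div_nonneg hB.le hA.le
  have e1 : (1 : ℝ) - 2 / (d + 2) = d / (d + 2) := by field_simp; ring
  have e2 : (1 : ℝ) - d / (d + 2) = 2 / (d + 2) := by field_simp; ring
  have e3 : (2 : ℝ) / (d + 2) * ((d : ℝ) / 2) = d / (d + 2) := by field_simp
  have hAw : 0 < A ^ ((d : ℝ) / (d + 2)) := Real.rpow_pos_of_pos hA _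
  have hBw : 0 < B ^ ((d : ℝ) / (d + 2)) := Real.rpow_pos_of_pos hB _
  have hA2 : 0 < A ^ ((2 : ℝ) / (d + 2)) := Real.rpow_pos_of_pos hA _
  -- `√(ρ^d) = ρ^{d∕2}` (the tree's `Literature.NumberTheory.Sieve.sqrt_pow_eq_rpow`, inlined to keep the import cone small)
  have hsq : Real.sqrt (((B / A) ^ ((2 : ℝ) / (d + 2))) ^ d) = ((B / A) ^ ((2 : ℝ) / (d + 2))) ^ ((d : ℝ) / 2) := by
    rw [Real.sqrt_eq_rpow, ← Real.rpow_natCast, ← Real.rpow_mul (Real.rpow_nonneg hBA _)]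
    congr 1
    ring
  refine ⟨?_, ?_⟩
  · rw [Real.div_rpow hB.le hA.le, ← e1, Real.rpow_sub hA, Real.rpow_one]
    field_simp
  · rw [hsq, ← Real.rpow_mul hBA, e3, Real.div_rpow hB.le hA.le, ← e2, Real.rpow_sub hB, Real.rpow_one]
    field_simp

/-- THE CORE OF THE OPTIMISATION.  `A, B > 0`, `1 ≤ n`; if `y ≤ A·r + B∕√((r+1)^d)` for every natural `r < n`, then with
the balance point `ρ := (B∕A)^{2∕(d+2)}` one has `y ≤ A^{d∕(d+2)}·B^{2∕(d+2)} + B∕√((min ρ n)^d)` — take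
`r := min ⌊ρ⌋₊ (n − 1)`, so that `r ≤ ρ` and `min ρ n ≤ r + 1`. [folklore] -/
theorem le_opt_core {d n : ℕ} (hn : 1 ≤ n) {y A B : ℝ} (hA : 0 < A) (hB : 0 < B)
    (h : ∀ r : ℕ, r < n → y ≤ A * r + B / Real.sqrt (((r + 1 : ℕ) : ℝ) ^ d)) :
    y ≤ A ^ ((d : ℝ) / (d + 2)) * B ^ ((2 : ℝ) / (d + 2)) +
      B / Real.sqrt ((min ((B / A) ^ ((2 : ℝ) / (d + 2))) (n : ℝ)) ^ d) := by
  obtain ⟨i1, i2⟩ := opt_identities d hA hB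
  set Φ := A ^ ((d : ℝ) / (d + 2)) * B ^ ((2 : ℝ) / (d + 2)) with hΦ
  set ρ := (B / A) ^ ((2 : ℝ) / (d + 2)) with hρ
  have hρ0 : 0 < ρ := Real.rpow_pos_of_pos (div_pos hB hA) _
  have hm0 : 0 < min ρ (n : ℝ) := lt_min hρ0 (by exact_mod_cast hn)
  set r : ℕ := min ⌊ρ⌋₊ (n - 1) with hr
  have hrn : r < n := lt_of_le_of_lt (min_le_right _ _) (by omega)
  have hrρ : (r : ℝ) ≤ ρ :=
    le_trans (by exact_mod_cast (min_le_left ⌊ρ⌋₊ (n - 1))) (Nat.floor_le hρ0.le)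
  -- `min ρ n ≤ r + 1`
  have hmin : min ρ (n : ℝ) ≤ ((r + 1 : ℕ) : ℝ) := by
    by_cases hc : ⌊ρ⌋₊ ≤ n - 1
    · have hr' : r = ⌊ρ⌋₊ := min_eq_left hc
      refine (min_le_left _ _).trans ?_
      rw [hr']
      push_cast
      exact (Nat.lt_floor_add_one ρ).le
    · have hr' : r = n - 1 := min_eq_right (by omega)
      refine (min_le_right _ _).trans (le_of_eq ?_)
      rw [hr']
      norm_cast
      omega
  have hy := h r hrn
  -- first term
  have hAr : A * r ≤ Φ := by rw [← i1]; exact mul_le_mul_of_nonneg_left hrρ hA.le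
  -- second term
  have hsq : Real.sqrt ((min ρ (n : ℝ)) ^ d) ≤ Real.sqrt (((r + 1 : ℕ) : ℝ) ^ d) :=
    Real.sqrt_le_sqrt (pow_le_pow_left₀ hm0.le hmin d)
  have hpos : 0 < Real.sqrt ((min ρ (n : ℝ)) ^ d) := Real.sqrt_pos.mpr (pow_pos hm0 d)
  have hBt : B / Real.sqrt (((r + 1 : ℕ) : ℝ) ^ d) ≤ B / Real.sqrt ((min ρ (n : ℝ)) ^ d) :=
    div_le_div_of_nonneg_left hB.le hpos hsq
  linarith

/-- **THE OPTIMISED TWO-TERM BOUND.**  `A, B ≥ 0`, `1 ≤ n`: if `y ≤ A·r + B∕√((r+1)^d)` for every natural `r < n`, then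
`y ≤ 2·A^{d∕(d+2)}·B^{2∕(d+2)} + B∕√(n^d)`.  (Main case by `le_opt_core`: `B∕√((min ρ n)^d)` is `= A^{d∕(d+2)}B^{2∕(d+2)}`
when `ρ ≤ n` and `= B∕√(n^d)` otherwise; degenerate cases `B = 0` by `r = 0`, `A = 0` by `r = n − 1`.) [folklore] -/
theorem le_two_mul_rpow_add_of_forall_lt {d n : ℕ} (hn : 1 ≤ n) {y A B : ℝ} (hA : 0 ≤ A) (hB : 0 ≤ B)
    (h : ∀ r : ℕ, r < n → y ≤ A * r + B / Real.sqrt (((r + 1 : ℕ) : ℝ) ^ d)) :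
    y ≤ 2 * (A ^ ((d : ℝ) / (d + 2)) * B ^ ((2 : ℝ) / (d + 2))) + B / Real.sqrt ((n : ℝ) ^ d) := by
  have hΦ0 : 0 ≤ A ^ ((d : ℝ) / (d + 2)) * B ^ ((2 : ℝ) / (d + 2)) :=
    mul_nonneg (Real.rpow_nonneg hA _) (Real.rpow_nonneg hB _)
  have hcut0 : 0 ≤ B / Real.sqrt ((n : ℝ) ^ d) := div_nonneg hB (Real.sqrt_nonneg _)
  rcases hB.eq_or_lt with hB0 | hB'
  · -- `B = 0`: take `r = 0`
    have h0 := h 0 (by omega)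
    have hz : (0 : ℝ) ^ ((2 : ℝ) / (d + 2)) = 0 := Real.zero_rpow (by positivity)
    rw [← hB0] at h0 ⊢
    simp only [Nat.cast_zero, mul_zero, zero_div, add_zero] at h0
    rw [hz, mul_zero, mul_zero, zero_div, add_zero]
    exact h0
  rcases hA.eq_or_lt with hA0 | hA'
  · -- `A = 0`: take `r = n − 1`
    have h1 := h (n - 1) (by omega)
    have hcast : ((n - 1 + 1 : ℕ) : ℝ) = n := by norm_cast; omega
    rw [← hA0, zero_mul, zero_add, hcast] at h1
    linarith
  -- main case
  have hcore := le_opt_core hn hA' hB' h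
  obtain ⟨_, i2⟩ := opt_identities d hA' hB'
  set ρ := (B / A) ^ ((2 : ℝ) / (d + 2)) with hρ
  by_cases hρn : ρ ≤ (n : ℝ)
  · rw [min_eq_left hρn, i2] at hcore
    linarith
  · rw [min_eq_right (le_of_not_ge hρn)] at hcore
    linarith

/-- **BULK REGIME: NO CUT-OFF TERM.**  If moreover `B² ≤ A²·n^{d+2}` (equivalently the balance point `ρ ≤ n`), then
`y ≤ 2·A^{d∕(d+2)}·B^{2∕(d+2)}`. [folklore] -/
theorem le_two_mul_rpow_of_forall_lt_of_sq_le {d n : ℕ} (hn : 1 ≤ n) {y A B : ℝ} (hA : 0 ≤ A) (hB : 0 ≤ B)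
    (hbulk : B ^ 2 ≤ A ^ 2 * (n : ℝ) ^ (d + 2))
    (h : ∀ r : ℕ, r < n → y ≤ A * r + B / Real.sqrt (((r + 1 : ℕ) : ℝ) ^ d)) :
    y ≤ 2 * (A ^ ((d : ℝ) / (d + 2)) * B ^ ((2 : ℝ) / (d + 2))) := by
  have hΦ0 : 0 ≤ A ^ ((d : ℝ) / (d + 2)) * B ^ ((2 : ℝ) / (d + 2)) :=
    mul_nonneg (Real.rpow_nonneg hA _) (Real.rpow_nonneg hB _)
  rcases hB.eq_or_lt with hB0 | hB'
  · have h0 := h 0 (by omega)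
    have hz : (0 : ℝ) ^ ((2 : ℝ) / (d + 2)) = 0 := Real.zero_rpow (by positivity)
    rw [← hB0] at h0 ⊢
    simp only [Nat.cast_zero, mul_zero, zero_div, add_zero] at h0
    rw [hz, mul_zero, mul_zero]
    exact h0
  rcases hA.eq_or_lt with hA0 | hA'
  · -- `A = 0` forces `B = 0` by `hbulk`, contradicting `0 < B`
    exfalso
    rw [← hA0] at hbulk
    nlinarith
  have hcore := le_opt_core hn hA' hB' h
  obtain ⟨_, i2⟩ := opt_identities d hA' hB'
  set ρ := (B / A) ^ ((2 : ℝ) / (d + 2)) with hρ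
  -- `hbulk` ⇒ `ρ ≤ n`
  have hρn : ρ ≤ (n : ℝ) := by
    have hq : (B / A) ^ 2 ≤ (n : ℝ) ^ (d + 2) := by
      rw [div_pow, div_le_iff₀ (by positivity)]
      linarith [hbulk]
    have hn0 : (0 : ℝ) ≤ n := by positivity
    have e : (2 : ℝ) / (d + 2) = (2 : ℕ) * (((d + 2 : ℕ) : ℝ)⁻¹) := by push_cast; ring
    calc ρ = ((B / A) ^ 2) ^ (((d + 2 : ℕ) : ℝ)⁻¹) := by
          rw [hρ, e, Real.rpow_natCast_mul (div_nonneg hB'.le hA'.le)]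
      _ ≤ ((n : ℝ) ^ (d + 2)) ^ (((d + 2 : ℕ) : ℝ)⁻¹) :=
          Real.rpow_le_rpow (sq_nonneg _) hq (by positivity)
      _ = n := Real.pow_rpow_inv_natCast hn0 (by omega)
  rw [min_eq_left hρn, i2] at hcore
  linarith

/-- REWRITING THE CONSTANT: `A^{d∕(d+2)}·(√S)^{2∕(d+2)} = (A^d·S)^{1∕(d+2)}` for `A, S ≥ 0`. [folklore] -/
theorem rpow_mul_rpow_sqrt_eq {A S : ℝ} (hA : 0 ≤ A) (hS : 0 ≤ S) (d : ℕ) :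
    A ^ ((d : ℝ) / (d + 2)) * (Real.sqrt S) ^ ((2 : ℝ) / (d + 2)) = (A ^ d * S) ^ ((1 : ℝ) / (d + 2)) := by
  rw [Real.mul_rpow (pow_nonneg hA d) hS]
  congr 1
  · rw [← Real.rpow_natCast_mul hA]
    congr 1
    ring
  · rw [Real.sqrt_eq_rpow, ← Real.rpow_mul hS]
    congr 1
    ring

/-! ## §2 The lattice statements (over `LatticeSupFromEnergy` p214980 BY NAME) -/

variable {d : ℕ} (N : Fin d → ℕ) [hN : ∀ μ, NeZero (N μ)] {E : Type*} [SeminormedAddCommGroup E]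

/-- THE TRIVIAL BOUND `‖f x₀‖ ≤ √(Σ_x ‖f x‖²)` (one term of the sum), hypothesis-free. [folklore] -/
theorem norm_le_sqrt_sum_sq (f : Tor N → E) (x₀ : Tor N) : ‖f x₀‖ ≤ Real.sqrt (∑ x : Tor N, ‖f x‖ ^ 2) := by
  refine Real.le_sqrt_of_sq_le ?_
  exact Finset.single_le_sum (f := fun x => ‖f x‖ ^ 2) (fun x _ => sq_nonneg _) (Finset.mem_univ x₀)

/-- **THE ℓ² → SUP INTERPOLATION, OPTIMISED (closed) FORM.**  For a step-Lipschitz `f : Tor N → E`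
(`‖f (x + e_μ) − f x‖ ≤ λ`, `λ ≥ 0`) and any `n` with `1 ≤ n ≤ N_μ` for all `μ` (an admissible cube side),
`‖f x₀‖ ≤ 2·((d·λ)^d · Σ_x ‖f x‖²)^{1∕(d+2)} + √(Σ_x ‖f x‖²) ∕ √(n^d)`.  The second (mean-square) term is necessary:
for a constant `f ≡ c` one has `λ = 0` and `‖c‖ = √Σ ∕ √(N^d)`. [folklore] -/
theorem norm_le_rpow_of_stepLipschitz (f : Tor N → E) {lam : ℝ} (hlam : 0 ≤ lam)
    (hlip : ∀ (x : Tor N) (μ : Fin d), ‖f (x + unitVec N μ) - f x‖ ≤ lam) (x₀ : Tor N) {n : ℕ} (hn : 1 ≤ n)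
    (hnN : ∀ μ, n ≤ N μ) :
    ‖f x₀‖ ≤ 2 * (((d : ℝ) * lam) ^ d * ∑ x : Tor N, ‖f x‖ ^ 2) ^ ((1 : ℝ) / (d + 2)) +
      Real.sqrt (∑ x : Tor N, ‖f x‖ ^ 2) / Real.sqrt ((n : ℝ) ^ d) := by
  have hA : 0 ≤ (d : ℝ) * lam := by positivity
  have hS : 0 ≤ ∑ x : Tor N, ‖f x‖ ^ 2 := Finset.sum_nonneg fun x _ => sq_nonneg _
  rw [← rpow_mul_rpow_sqrt_eq hA hS d]
  refine le_two_mul_rpow_add_of_forall_lt hn hA (Real.sqrt_nonneg _) fun r hr => ?_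
  have h := norm_le_of_stepLipschitz_of_sum_sq N f hlam hlip x₀ (r := r) fun μ => lt_of_lt_of_le hr (hnN μ)
  calc ‖f x₀‖ ≤ d * r * lam + Real.sqrt (∑ x : Tor N, ‖f x‖ ^ 2) / Real.sqrt (((r + 1 : ℕ) : ℝ) ^ d) := h
    _ = d * lam * r + Real.sqrt (∑ x : Tor N, ‖f x‖ ^ 2) / Real.sqrt (((r + 1 : ℕ) : ℝ) ^ d) := by ring

/-- **BULK REGIME = THE `hI` SHAPE of `T4ConvexResponse.localRate_of_interpolation`.**  If the energy is not too large for
the torus, `Σ_x ‖f x‖² ≤ (d·λ)²·n^{d+2}` (the balance point fits inside the admissible cubes), then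
`‖f x₀‖ ≤ 2·(d·λ)^{d∕(d+2)}·(√(Σ_x ‖f x‖²))^{2∕(d+2)}` — `C_I·E^a·M^{1−a}` with `E = √Σ`, `M = d·λ`, `a = 2∕(d+2)`,
`C_I = 2`. [folklore] -/
theorem norm_le_rpow_of_stepLipschitz_of_bulk (f : Tor N → E) {lam : ℝ} (hlam : 0 ≤ lam)
    (hlip : ∀ (x : Tor N) (μ : Fin d), ‖f (x + unitVec N μ) - f x‖ ≤ lam) (x₀ : Tor N) {n : ℕ} (hn : 1 ≤ n)
    (hnN : ∀ μ, n ≤ N μ) (hbulk : ∑ x : Tor N, ‖f x‖ ^ 2 ≤ ((d : ℝ) * lam) ^ 2 * (n : ℝ) ^ (d + 2)) :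
    ‖f x₀‖ ≤ 2 * (((d : ℝ) * lam) ^ ((d : ℝ) / (d + 2)) *
      (Real.sqrt (∑ x : Tor N, ‖f x‖ ^ 2)) ^ ((2 : ℝ) / (d + 2))) := by
  have hA : 0 ≤ (d : ℝ) * lam := by positivity
  have hS : 0 ≤ ∑ x : Tor N, ‖f x‖ ^ 2 := Finset.sum_nonneg fun x _ => sq_nonneg _
  refine le_two_mul_rpow_of_forall_lt_of_sq_le hn hA (Real.sqrt_nonneg _) (by rwa [Real.sq_sqrt hS]) fun r hr => ?_
  have h := norm_le_of_stepLipschitz_of_sum_sq N f hlam hlip x₀ (r := r) fun μ => lt_of_lt_of_le hr (hnN μ)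
  calc ‖f x₀‖ ≤ d * r * lam + Real.sqrt (∑ x : Tor N, ‖f x‖ ^ 2) / Real.sqrt (((r + 1 : ℕ) : ℝ) ^ d) := h
    _ = d * lam * r + Real.sqrt (∑ x : Tor N, ‖f x‖ ^ 2) / Real.sqrt (((r + 1 : ℕ) : ℝ) ^ d) := by ring

/-- **PHYSICAL UNITS — THE DISPLAYED CONSTANT `C_d = 2·d^{d∕(d+2)}`.**  A `Λ`-Lipschitz field sampled at mesh `η` is
step-Lipschitz with `λ = Λ·η`; then
`‖f x₀‖ ≤ 2·d^{d∕(d+2)}·(Λ^d·η^d·Σ_x ‖f x‖²)^{1∕(d+2)} + √(Σ_x ‖f x‖²) ∕ √(n^d)` (`1 ≤ n ≤ N_μ`, `Λ, η ≥ 0`). [folklore] -/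
theorem norm_le_rpow_of_lipschitz_mesh (f : Tor N → E) {Λ η : ℝ} (hΛ : 0 ≤ Λ) (hη : 0 ≤ η)
    (hlip : ∀ (x : Tor N) (μ : Fin d), ‖f (x + unitVec N μ) - f x‖ ≤ Λ * η) (x₀ : Tor N) {n : ℕ} (hn : 1 ≤ n)
    (hnN : ∀ μ, n ≤ N μ) :
    ‖f x₀‖ ≤ 2 * (d : ℝ) ^ ((d : ℝ) / (d + 2)) * (Λ ^ d * η ^ d * ∑ x : Tor N, ‖f x‖ ^ 2) ^ ((1 : ℝ) / (d + 2)) +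
      Real.sqrt (∑ x : Tor N, ‖f x‖ ^ 2) / Real.sqrt ((n : ℝ) ^ d) := by
  have hS : 0 ≤ ∑ x : Tor N, ‖f x‖ ^ 2 := Finset.sum_nonneg fun x _ => sq_nonneg _
  have h := norm_le_rpow_of_stepLipschitz N f (mul_nonneg hΛ hη) hlip x₀ hn hnN
  have hd0 : (0 : ℝ) ≤ d := by positivity
  have key : (((d : ℝ) * (Λ * η)) ^ d * ∑ x : Tor N, ‖f x‖ ^ 2) ^ ((1 : ℝ) / (d + 2))
      = (d : ℝ) ^ ((d : ℝ) / (d + 2)) * (Λ ^ d * η ^ d * ∑ x : Tor N, ‖f x‖ ^ 2) ^ ((1 : ℝ) / (d + 2)) := by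
    rw [show ((d : ℝ) * (Λ * η)) ^ d * ∑ x : Tor N, ‖f x‖ ^ 2
        = (d : ℝ) ^ d * (Λ ^ d * η ^ d * ∑ x : Tor N, ‖f x‖ ^ 2) by ring,
      Real.mul_rpow (pow_nonneg hd0 d) (by positivity), ← Real.rpow_natCast_mul hd0]
    congr 2
    ring
  rw [key] at h
  linarith

/-! ## §3 The anchored-box statement (over road P3's `LatticeSupInterpolation` BY NAME) -/

section AnchoredBox

open Summit.QuantumFields.BalabanUV.T4Continuum.LatticeSupInterpolation (anchoredBox abs_le_modulus_add_mass)

omit hN in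
/-- smaller anchored boxes sit inside larger ones. [folklore] -/
theorem anchoredBox_mono (x₀ : Fin d → ℤ) {k m : ℕ} (hkm : k ≤ m) : anchoredBox x₀ k ⊆ anchoredBox x₀ m := by
  unfold anchoredBox
  refine Finset.Icc_subset_Icc_right fun i => ?_
  simp only [Pi.add_apply, add_le_add_iff_left]
  exact_mod_cast hkm

omit hN in
/-- **P3's (F₀) DICTIONARY «`w = h^d`, `M = Λ·d·k·h`, optimise `k`» — DONE.**  If on every anchored box of side `k < n`
the lower modulus `|f x₀| − A·k ≤ |f y|` holds (`A = Λ·d·h` for a `Λ`-Lipschitz field at mesh `h`), and the weighted mass of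
the largest box is `w·Σ_{anchoredBox x₀ (n−1)} f² ≤ δ²` (`w > 0`, `δ ≥ 0`), then
`|f x₀| ≤ 2·A^{d∕(d+2)}·(δ∕√w)^{2∕(d+2)} + (δ∕√w) ∕ √(n^d)` — `LatticeSupInterpolation.abs_le_modulus_add_mass` for every
`k < n` (mass by monotonicity of the boxes) fed into `le_two_mul_rpow_add_of_forall_lt`. [folklore] -/
theorem abs_le_rpow_of_modulus_mass (x₀ : Fin d → ℤ) (f : (Fin d → ℤ) → ℝ) {A w δ : ℝ} (hA : 0 ≤ A) (hw : 0 < w)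
    (hδ : 0 ≤ δ) {n : ℕ} (hn : 1 ≤ n)
    (hmod : ∀ k : ℕ, k < n → ∀ y ∈ anchoredBox x₀ k, |f x₀| - A * k ≤ |f y|)
    (hmass : w * ∑ y ∈ anchoredBox x₀ (n - 1), f y ^ 2 ≤ δ ^ 2) :
    |f x₀| ≤ 2 * (A ^ ((d : ℝ) / (d + 2)) * (δ / Real.sqrt w) ^ ((2 : ℝ) / (d + 2))) +
      δ / Real.sqrt w / Real.sqrt ((n : ℝ) ^ d) := by
  have hB : 0 ≤ δ / Real.sqrt w := div_nonneg hδ (Real.sqrt_nonneg w)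
  refine le_two_mul_rpow_add_of_forall_lt hn hA hB fun r hr => ?_
  have hmass_r : w * ∑ y ∈ anchoredBox x₀ r, f y ^ 2 ≤ δ ^ 2 := by
    refine le_trans (mul_le_mul_of_nonneg_left ?_ hw.le) hmass
    exact Finset.sum_le_sum_of_subset_of_nonneg (anchoredBox_mono x₀ (by omega)) fun y _ _ => sq_nonneg _
  have h := abs_le_modulus_add_mass x₀ r f (hmod r hr) hw hδ hmass_r
  have hsw : 0 < Real.sqrt w := Real.sqrt_pos.mpr hw
  have e : δ / Real.sqrt (w * ((r : ℝ) + 1) ^ d) = δ / Real.sqrt w / Real.sqrt (((r + 1 : ℕ) : ℝ) ^ d) := by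
    rw [Real.sqrt_mul hw.le, div_div]
    push_cast
    ring
  rw [e] at h
  exact h

end AnchoredBox

end Summit.QuantumFields.BalabanUV.T4Continuum.LatticeSupOptimised

end
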